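import Mathlib.Analysis.InnerProductSpace.PiL2
import Mathlib.Analysis.InnerProductSpace.Projection.Submodule
import Mathlib.Analysis.LocallyConvex.Separation
import Mathlib.Analysis.Matrix.Order
import Mathlib.LinearAlgebra.Matrix.PosDef
import Mathlib.LinearAlgebra.Finsupp.LinearCombination
import HarnessLib

/-!
# A theorem of the alternative for semidefinite feasibility (Gribling–de Laat–Laurent 2017, Lemma 3.8)

Source. S. Gribling, D. de Laat, M. Laurent, *Matrices with high completely positive semidefinite
rank*, Linear Algebra Appl. 513 (2017) 122–148 = arXiv:1605.00988 [GriblingDelaatLaurent2017], §3.2,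
Lemma 3.8 (held text `paper:arxiv-1605.00988`, chunk p10, verbatim): "Given `A_1,…,A_m ∈ 𝒮^n` and
`b ∈ ℝ^m`, and assume that there exists a matrix `X ∈ 𝒮^n` such that `⟨A_j, X⟩ = b_j` for all
`j ∈ [m]`. Then exactly one of the following two alternatives holds: (i) There exists a matrix `X ≻ 0`
such that `⟨A_j, X⟩ = b_j` for all `j ∈ [m]`. (ii) There exists `y ∈ ℝ^m` such that
`Ω = Σ_{j=1}^m y_jA_j ⪰ 0`, `Ω ≠ 0`, and `ΩX = 0`." (GdLL: "the following basic property of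
semidefinite programs (which can be seen as an analog of Farkas' lemma for linear programs)"; used
in their proof of Theorem 3.9 (i), Tsirelson's certificate for extreme bipartite correlations.)

Typed over real symmetric matrices on a finite index type, with `⟨A, X⟩ = Tr(AX)` and the given
feasible point `X` positive semidefinite (the case needed in GdLL's application; with a psd `X`,
alternative (ii)'s `ΩX = 0` is the complementarity `Tr(ΩX) = 0`). PROVED: `GriblingDelaatLaurent2017_lemma38`
("at least one alternative": if no positive definite feasible point exists then (ii) holds) and
`GriblingDelaatLaurent2017_lemma38_not_both` (the alternatives exclude each other). Own proof (GdLL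
give none): separate the open convex cone of positive definite forms from the linear subspace
`{X symmetric : ⟨A_j, X⟩ ∈ ℝ b}` (geometric Hahn–Banach in the Euclidean space of matrices), read the
functional as a symmetric matrix `Ω ⪰ 0`, and identify the orthogonal complement of
`{X symmetric : ⟨A_j, X⟩ = 0 ∀j}` with `span{A_j}`.
-/

noncomputable section

open Matrix Finset
open scoped RealInnerProductSpace MatrixOrder

namespace Literature.Combinatorics.Optimization

section SdpPlumbing

variable {ι : Type*}

/-- Vectorisation of a real matrix as a Euclidean vector indexed by `ι × ι` (plumbing). [folklore] -/
private def vecMat (M : Matrix ι ι ℝ) : EuclideanSpace ℝ (ι × ι) := WithLp.toLp 2 fun p => M p.1 p.2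

/-- The matrix of a Euclidean vector indexed by `ι × ι` (plumbing). [folklore] -/
private def matVec (w : EuclideanSpace ℝ (ι × ι)) : Matrix ι ι ℝ := Matrix.of fun p q => w (p, q)

/-- `mat (vec M) = M` (plumbing). [folklore] -/
private theorem matVec_vecMat (M : Matrix ι ι ℝ) : matVec (vecMat M) = M := by
  ext p q; rfl

/-- Entries of `mat w` (plumbing). [folklore] -/
private theorem matVec_apply (w : EuclideanSpace ℝ (ι × ι)) (p q : ι) : matVec w p q = w (p, q) := rfl

/-- `mat` is additive (plumbing). [folklore] -/
private theorem matVec_add (w w' : EuclideanSpace ℝ (ι × ι)) :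
    matVec (w + w') = matVec w + matVec w' := by
  ext p q; rfl

/-- `mat` respects subtraction (plumbing). [folklore] -/
private theorem matVec_sub (w w' : EuclideanSpace ℝ (ι × ι)) :
    matVec (w - w') = matVec w - matVec w' := by
  ext p q; rfl

/-- `mat` is homogeneous (plumbing). [folklore] -/
private theorem matVec_smul (c : ℝ) (w : EuclideanSpace ℝ (ι × ι)) :
    matVec (c • w) = c • matVec w := by
  ext p q; rfl

/-- `vec` is additive (plumbing). [folklore] -/
private theorem vecMat_add (M N : Matrix ι ι ℝ) : vecMat (M + N) = vecMat M + vecMat N := by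
  ext p; rfl

/-- `vec` is homogeneous (plumbing). [folklore] -/
private theorem vecMat_smul (c : ℝ) (M : Matrix ι ι ℝ) : vecMat (c • M) = c • vecMat M := by
  ext p; rfl

/-- `vec` of a finite sum (plumbing). [folklore] -/
private theorem vecMat_sum {J : Type*} (s : Finset J) (M : J → Matrix ι ι ℝ) :
    vecMat (∑ j ∈ s, M j) = ∑ j ∈ s, vecMat (M j) := by
  classical
  induction s using Finset.induction_on with
  | empty => ext p; rfl
  | insert j s hj ih => rw [Finset.sum_insert hj, Finset.sum_insert hj, vecMat_add, ih]

variable [Fintype ι]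

/-- `⟨vec M, vec N⟩ = Σ_{p,q} M_{pq}N_{pq}`. [folklore] -/
private theorem inner_vecMat (M N : Matrix ι ι ℝ) :
    ⟪vecMat M, vecMat N⟫ = ∑ p, ∑ q, M p q * N p q := by
  rw [vecMat, vecMat, EuclideanSpace.inner_toLp_toLp, star_trivial, dotProduct,
    Fintype.sum_prod_type]
  exact Finset.sum_congr rfl fun p _ => Finset.sum_congr rfl fun q _ => mul_comm _ _

/-- `⟨w, vec N⟩ = Σ_{p,q} (mat w)_{pq} N_{pq}`. [folklore] -/
private theorem inner_vecMat_right (w : EuclideanSpace ℝ (ι × ι)) (N : Matrix ι ι ℝ) :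
    ⟪w, vecMat N⟫ = ∑ p, ∑ q, matVec w p q * N p q := by
  rw [← inner_vecMat, matVec_vecMat']
where
  matVec_vecMat' : vecMat (matVec w) = w := by ext p; rfl

/-- The quadratic form of a dyad: `u·(vvᵀ)u = (v·u)²`. [folklore] -/
private theorem dotProduct_vecMulVec_mulVec' (v u : ι → ℝ) :
    u ⬝ᵥ (vecMulVec v v *ᵥ u) = (v ⬝ᵥ u) ^ 2 := by
  simp only [dotProduct, mulVec, vecMulVec_apply, Finset.mul_sum, sq, Finset.sum_mul]
  rw [Finset.sum_comm]
  exact Finset.sum_congr rfl fun i _ ↦ Finset.sum_congr rfl fun j _ ↦ by ring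

/-- `Tr(MN) = Σ_{p,q} M_{pq}N_{pq}` for symmetric `N`. [folklore] -/
private theorem trace_mul_eq_sum_of_isSymm (M N : Matrix ι ι ℝ) (hN : N.IsSymm) :
    (M * N).trace = ∑ p, ∑ q, M p q * N p q := by
  simp only [Matrix.trace, Matrix.diag_apply, Matrix.mul_apply]
  refine Finset.sum_congr rfl fun p _ => Finset.sum_congr rfl fun q _ => ?_
  rw [show N q p = N p q from by
    have := congrFun (congrFun hN p) q; simpa [Matrix.transpose_apply] using this]

/-- For symmetric `M`, `Σ_{p,q} M_{pq}N_{pq} = Σ_{p,q} M_{pq}N_{qp}`: pairing a symmetric matrix with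
`N` only sees the symmetric part of `N`. [folklore] -/
private theorem sum_mul_eq_sum_mul_transpose_of_isSymm (M N : Matrix ι ι ℝ) (hM : M.IsSymm) :
    ∑ p, ∑ q, M p q * N p q = ∑ p, ∑ q, M p q * N q p := by
  rw [Finset.sum_comm]
  refine Finset.sum_congr rfl fun p _ => Finset.sum_congr rfl fun q _ => ?_
  rw [show M q p = M p q from by
    have := congrFun (congrFun hM p) q; simpa [Matrix.transpose_apply] using this]

/-- A coordinate is bounded by the Euclidean norm. [folklore] -/
private theorem abs_apply_le_norm' {κ : Type*} [Fintype κ] (x : EuclideanSpace ℝ κ) (k : κ) :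
    |x k| ≤ ‖x‖ := by
  have h1 : (x k) ^ 2 ≤ ‖x‖ ^ 2 := by
    rw [EuclideanSpace.real_norm_sq_eq]
    exact Finset.single_le_sum (f := fun j => (x j) ^ 2) (fun j _ => sq_nonneg _) (Finset.mem_univ k)
  calc |x k| = Real.sqrt ((x k) ^ 2) := (Real.sqrt_sq_eq_abs _).symm
    _ ≤ Real.sqrt (‖x‖ ^ 2) := Real.sqrt_le_sqrt h1
    _ = ‖x‖ := Real.sqrt_sq (norm_nonneg _)

/-- The real quadratic form `v ↦ vᵀSv` in coordinates. [folklore] -/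
private theorem dotProduct_mulVec_eq_sum (S : Matrix ι ι ℝ) (v : ι → ℝ) :
    v ⬝ᵥ (S *ᵥ v) = ∑ p, ∑ q, S p q * (v p * v q) := by
  simp only [dotProduct, mulVec, Finset.mul_sum]
  exact Finset.sum_congr rfl fun p _ => Finset.sum_congr rfl fun q _ => by ring

/-- `|Σ_{p,q} D_{pq} v_pv_q| ≤ |ι|²·(max |D_{pq}|-bound)·Σ v_p²`: a crude bound for the perturbation of
a quadratic form, with every `|D_{pq}| ≤ δ`. [folklore] -/
private theorem abs_sum_mul_le (D : Matrix ι ι ℝ) (δ : ℝ) (hD : ∀ p q, |D p q| ≤ δ) (v : ι → ℝ) :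
    |∑ p, ∑ q, D p q * (v p * v q)| ≤ (Fintype.card ι) ^ 2 * δ * ∑ p, v p * v p := by
  set V : ℝ := ∑ p, v p * v p with hVdef
  have hV0 : 0 ≤ V := Finset.sum_nonneg fun p _ => mul_self_nonneg (v p)
  have hvp : ∀ p, v p * v p ≤ V := fun p =>
    Finset.single_le_sum (f := fun p => v p * v p) (fun q _ => mul_self_nonneg (v q)) (Finset.mem_univ p)
  have hpq : ∀ p q, |v p| * |v q| ≤ V := fun p q => by
    have h1 : |v p| * |v q| ≤ (v p * v p + v q * v q) / 2 := by
      have := two_mul_le_add_sq (|v p|) (|v q|)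
      rw [← abs_mul_abs_self (v p), ← abs_mul_abs_self (v q)]
      nlinarith
    linarith [hvp p, hvp q]
  calc |∑ p, ∑ q, D p q * (v p * v q)| ≤ ∑ p, |∑ q, D p q * (v p * v q)| := Finset.abs_sum_le_sum_abs _ _
    _ ≤ ∑ p, ∑ q, |D p q * (v p * v q)| := Finset.sum_le_sum fun p _ => Finset.abs_sum_le_sum_abs _ _
    _ ≤ ∑ p, ∑ q, δ * V := by
        refine Finset.sum_le_sum fun p _ => Finset.sum_le_sum fun q _ => ?_
        rw [abs_mul, abs_mul]
        exact mul_le_mul (hD p q) (hpq p q) (mul_nonneg (abs_nonneg _) (abs_nonneg _))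
          ((abs_nonneg _).trans (hD p q))
    _ = (Fintype.card ι) ^ 2 * δ * V := by
        rw [Finset.sum_const, Finset.sum_const, Finset.card_univ, smul_smul, nsmul_eq_mul]
        push_cast; ring

end SdpPlumbing

section SdpAlternative

variable {ι : Type*} [Fintype ι] [DecidableEq ι]

/-- The set of (vectorised) matrices whose symmetrisation is positive definite as a form is OPEN in
the Euclidean space of matrices (coercivity on the unit sphere plus the crude perturbation bound).
[folklore] -/
private theorem isOpen_setOf_symmPosDef :
    IsOpen {w : EuclideanSpace ℝ (ι × ι) |
      ∀ v : ι → ℝ, v ≠ 0 → 0 < v ⬝ᵥ ((matVec w + (matVec w)ᵀ) *ᵥ v)} := by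
  classical
  rw [Metric.isOpen_iff]
  intro w₀ hw₀
  set S₀ : Matrix ι ι ℝ := matVec w₀ + (matVec w₀)ᵀ with hS₀
  -- coercivity: `c Σ v_p² ≤ vᵀ S₀ v` with `c > 0`
  obtain ⟨c, hc, hcoer⟩ : ∃ c : ℝ, 0 < c ∧ ∀ v : ι → ℝ, c * ∑ p, v p * v p ≤ v ⬝ᵥ (S₀ *ᵥ v) := by
    rcases isEmpty_or_nonempty ι with hι | hι
    · exact ⟨1, one_pos, fun v => by simp [dotProduct]⟩
    · -- minimum over the unit sphere of `ℝ^ι`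
      let g : EuclideanSpace ℝ ι → ℝ := fun u => (WithLp.ofLp u) ⬝ᵥ (S₀ *ᵥ WithLp.ofLp u)
      have hg : Continuous g := by
        simp only [g, dotProduct, mulVec]
        fun_prop
      have hK : IsCompact (Metric.sphere (0 : EuclideanSpace ℝ ι) 1) := isCompact_sphere _ _
      obtain ⟨i⟩ := hι
      have hne : (Metric.sphere (0 : EuclideanSpace ℝ ι) 1).Nonempty :=
        ⟨EuclideanSpace.single i (1 : ℝ), by simp [PiLp.norm_single]⟩
      obtain ⟨u₀, hu₀, hmin⟩ := hK.exists_isMinOn hne hg.continuousOn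
      have hu₀ne : WithLp.ofLp u₀ ≠ 0 := by
        intro h
        have : u₀ = 0 := by
          ext k; exact congrFun h k
        rw [this] at hu₀
        simp at hu₀
      refine ⟨g u₀, hw₀ _ hu₀ne, fun v => ?_⟩
      by_cases hv : v = 0
      · subst hv; simp [dotProduct]
      · -- scale `v` to the sphere
        let vE : EuclideanSpace ℝ ι := WithLp.toLp 2 v
        have hvE : vE ≠ 0 := by
          intro h; apply hv; funext k
          have := congrArg (fun z : EuclideanSpace ℝ ι => z k) h
          simpa [vE] using this
        have hnorm : 0 < ‖vE‖ := norm_pos_iff.mpr hvE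
        let u : EuclideanSpace ℝ ι := ‖vE‖⁻¹ • vE
        have hu : u ∈ Metric.sphere (0 : EuclideanSpace ℝ ι) 1 := by
          rw [mem_sphere_zero_iff_norm, norm_smul, norm_inv, norm_norm, inv_mul_cancel₀ hnorm.ne']
        have hmin' : g u₀ ≤ g u := hmin hu
        have hgu : g u = ‖vE‖⁻¹ * ‖vE‖⁻¹ * (v ⬝ᵥ (S₀ *ᵥ v)) := by
          simp only [g, u, vE, WithLp.ofLp_smul, dotProduct_smul, mulVec_smul, smul_dotProduct,
            smul_eq_mul]
          ring
        have hVn : ∑ p, v p * v p = ‖vE‖ ^ 2 := by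
          rw [EuclideanSpace.real_norm_sq_eq]
          exact Finset.sum_congr rfl fun p _ => by simp [vE, sq]
        rw [hVn]
        have h2 : g u₀ * ‖vE‖ ^ 2 ≤ g u * ‖vE‖ ^ 2 := mul_le_mul_of_nonneg_right hmin' (sq_nonneg _)
        calc g u₀ * ‖vE‖ ^ 2 ≤ g u * ‖vE‖ ^ 2 := h2
          _ = v ⬝ᵥ (S₀ *ᵥ v) := by rw [hgu]; field_simp
  -- the ball of radius `ε`
  set N : ℝ := (Fintype.card ι : ℝ) ^ 2 with hNdef
  refine ⟨c / (4 * N + 4), by positivity, fun w hw v hv => ?_⟩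
  rw [Metric.mem_ball] at hw
  have hVpos : 0 < ∑ p, v p * v p := by
    obtain ⟨p, hp⟩ : ∃ p, v p ≠ 0 := by
      by_contra h; push Not at h; exact hv (funext h)
    exact lt_of_lt_of_le (mul_self_pos.mpr hp)
      (Finset.single_le_sum (f := fun p => v p * v p) (fun q _ => mul_self_nonneg (v q)) (Finset.mem_univ p))
  -- `vᵀ S_w v = vᵀ S₀ v + vᵀ (D + Dᵀ) v`, `D = mat(w − w₀)`
  set D : Matrix ι ι ℝ := matVec (w - w₀) with hDdef
  have hsplit : matVec w + (matVec w)ᵀ = S₀ + (D + Dᵀ) := by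
    rw [hS₀, hDdef, matVec_sub, Matrix.transpose_sub]; abel
  have hDb : ∀ p q, |D p q| ≤ ‖w - w₀‖ := fun p q => by
    rw [hDdef, matVec_apply]; exact abs_apply_le_norm' _ _
  have hDTb : ∀ p q, |(D + Dᵀ) p q| ≤ 2 * ‖w - w₀‖ := fun p q => by
    rw [Matrix.add_apply, Matrix.transpose_apply]
    calc |D p q + D q p| ≤ |D p q| + |D q p| := abs_add_le _ _
      _ ≤ ‖w - w₀‖ + ‖w - w₀‖ := add_le_add (hDb p q) (hDb q p)
      _ = 2 * ‖w - w₀‖ := by ring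
  have hpert := abs_sum_mul_le (D + Dᵀ) (2 * ‖w - w₀‖) hDTb v
  rw [hsplit, add_mulVec, dotProduct_add, dotProduct_mulVec_eq_sum (D + Dᵀ)]
  have h1 := hcoer v
  have hdist : ‖w - w₀‖ < c / (4 * N + 4) := by rwa [← dist_eq_norm]
  have hN0 : 0 ≤ N := by positivity
  -- `N² · 2‖w−w₀‖ · V < c V / 2`
  have h3 : N * (2 * ‖w - w₀‖) * ∑ p, v p * v p < c * ∑ p, v p * v p := by
    have h4 : N * (2 * ‖w - w₀‖) < c := by
      calc N * (2 * ‖w - w₀‖) ≤ N * (2 * (c / (4 * N + 4))) := by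
            exact mul_le_mul_of_nonneg_left (by linarith) hN0
        _ = c * (N / (2 * N + 2)) := by field_simp; ring
        _ < c := by
            have : N / (2 * N + 2) < 1 := by rw [div_lt_one (by positivity)]; linarith
            nlinarith
    exact mul_lt_mul_of_pos_right h4 hVpos
  have h5 := neg_abs_le (∑ p, ∑ q, (D + Dᵀ) p q * (v p * v q))
  nlinarith [hpert, h1, h3, h5, sq_nonneg N]

/-- Complementarity: for real psd `Ω, X` with `Tr(ΩX) = 0` one has `ΩX = 0` (`X = BᵀB`, each row
`b` of `B` has `bᵀΩb = 0`, hence `Ωb = 0`). [folklore] -/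
private theorem mul_eq_zero_of_posSemidef_trace {Ω X : Matrix ι ι ℝ} (hΩ : Ω.PosSemidef)
    (hX : X.PosSemidef) (h : (Ω * X).trace = 0) : Ω * X = 0 := by
  classical
  obtain ⟨B, hB⟩ := CStarAlgebra.nonneg_iff_eq_star_mul_self.mp hX.nonneg
  have hBT : star B = Bᵀ := by
    rw [star_eq_conjTranspose, conjTranspose_eq_transpose_of_trivial]
  rw [hBT] at hB
  -- `Tr(ΩBᵀB) = Σ_i b_iᵀ Ω b_i`
  have hrows : ∀ i, 0 ≤ star (fun q => B i q) ⬝ᵥ (Ω *ᵥ fun q => B i q) := fun i =>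
    hΩ.dotProduct_mulVec_nonneg _
  have hsum : ∑ i, star (fun q => B i q) ⬝ᵥ (Ω *ᵥ fun q => B i q) = 0 := by
    rw [← h, hB, ← Matrix.mul_assoc, Matrix.trace_mul_comm, ← Matrix.mul_assoc, Matrix.trace]
    refine Finset.sum_congr rfl fun i _ => ?_
    simp only [Matrix.diag_apply, Matrix.mul_apply, Matrix.transpose_apply, star_trivial, dotProduct,
      mulVec, Finset.sum_mul, Finset.mul_sum]
    rw [Finset.sum_comm]
    exact Finset.sum_congr rfl fun p _ => Finset.sum_congr rfl fun q _ => by ring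
  have hzero : ∀ i, Ω *ᵥ (fun q => B i q) = 0 := fun i =>
    (hΩ.dotProduct_mulVec_zero_iff _).mp
      ((Finset.sum_eq_zero_iff_of_nonneg fun i _ => hrows i).mp hsum i (Finset.mem_univ i))
  have hΩBT : Ω * Bᵀ = 0 := by
    ext p i
    have := congrFun (hzero i) p
    simpa [Matrix.mul_apply, mulVec, dotProduct, Matrix.transpose_apply] using this
  rw [hB, ← Matrix.mul_assoc, hΩBT, Matrix.zero_mul]

/-- **GdLL Lemma 3.8 — a theorem of the alternative for semidefinite feasibility** (p10, verbatim:
"Given `A_1,…,A_m ∈ 𝒮^n` and `b ∈ ℝ^m`, and assume that there exists a matrix `X ∈ 𝒮^n` such that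
`⟨A_j, X⟩ = b_j` for all `j ∈ [m]`. Then exactly one of the following two alternatives holds:
(i) There exists a matrix `X ≻ 0` such that `⟨A_j, X⟩ = b_j` for all `j ∈ [m]`. (ii) There exists
`y ∈ ℝ^m` such that `Ω = Σ_j y_jA_j ⪰ 0`, `Ω ≠ 0`, and `ΩX = 0`."), the direction "not (i) ⇒ (ii)",
typed for real symmetric `A_j`, `⟨A, X⟩ = Tr(AX)`, and a positive semidefinite feasible point `X₀`
(as in GdLL's use for Theorem 3.9 (i); for a merely symmetric feasible `X` only `⟨Ω, X⟩ = 0` survives —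
`A = E₁₁`, `b = 0`, `X = E₁₂ + E₂₁` has `ΩX ≠ 0` — so the psd case is the faithful reading of the
printed `ΩX = 0`). Own proof (the source gives none): geometric Hahn–Banach
between the open convex cone of positive definite quadratic forms and the linear subspace
`{X symmetric : (Tr(A_jX))_j ∈ ℝb}` in the Euclidean space of matrices; the separating functional is
a symmetric `Ω ⪰ 0` with `Tr Ω > 0`, vanishing on that subspace (so `Tr(ΩX₀) = 0`, hence `ΩX₀ = 0`),
and lying in `span{A_j}` because it is orthogonal to `{X symmetric : Tr(A_jX) = 0 ∀j}`.
[cite: GriblingDelaatLaurent2017, Lemma 3.8 (p10)] -/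
theorem GriblingDelaatLaurent2017_lemma38 {J : Type*} [Fintype J] (A : J → Matrix ι ι ℝ)
    (hA : ∀ j, (A j).IsSymm) (b : J → ℝ) (X₀ : Matrix ι ι ℝ) (hX₀ : X₀.PosSemidef)
    (hfeas : ∀ j, (A j * X₀).trace = b j)
    (hno : ¬ ∃ X : Matrix ι ι ℝ, X.PosDef ∧ ∀ j, (A j * X).trace = b j) :
    ∃ y : J → ℝ, (∑ j, y j • A j).PosSemidef ∧ (∑ j, y j • A j) ≠ 0 ∧ (∑ j, y j • A j) * X₀ = 0 := by
  classical
  -- the open convex cone `s` and the subspace `t`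
  let s : Set (EuclideanSpace ℝ (ι × ι)) :=
    {w | ∀ v : ι → ℝ, v ≠ 0 → 0 < v ⬝ᵥ ((matVec w + (matVec w)ᵀ) *ᵥ v)}
  let t : Set (EuclideanSpace ℝ (ι × ι)) :=
    {w | (matVec w).IsSymm ∧ ∃ c : ℝ, ∀ j, (A j * matVec w).trace = c * b j}
  have hX₀symm : X₀.IsSymm := by
    have h := hX₀.1
    unfold Matrix.IsHermitian at h
    rw [conjTranspose_eq_transpose_of_trivial] at h
    exact h
  have hX₀q : ∀ v : ι → ℝ, 0 ≤ v ⬝ᵥ (X₀ *ᵥ v) := fun v => by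
    have := hX₀.dotProduct_mulVec_nonneg v
    rwa [star_trivial] at this
  have hherm : ∀ X : Matrix ι ι ℝ, X.IsSymm → X.IsHermitian := fun X hX => by
    unfold Matrix.IsHermitian; rw [conjTranspose_eq_transpose_of_trivial]; exact hX
  have hs₁ : Convex ℝ s := by
    intro w hw w' hw' a c ha hc hac v hv
    have hlin : matVec (a • w + c • w') + (matVec (a • w + c • w'))ᵀ =
        a • (matVec w + (matVec w)ᵀ) + c • (matVec w' + (matVec w')ᵀ) := by
      rw [matVec_add, matVec_smul, matVec_smul, Matrix.transpose_add, Matrix.transpose_smul,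
        Matrix.transpose_smul]
      simp only [smul_add]; abel
    rw [hlin, add_mulVec, smul_mulVec, smul_mulVec, dotProduct_add, dotProduct_smul,
      dotProduct_smul, smul_eq_mul, smul_eq_mul]
    have h1 := hw v hv
    have h2 := hw' v hv
    rcases ha.lt_or_eq with ha' | ha'
    · nlinarith
    · rw [← ha'] at hac ⊢; rw [zero_add] at hac; rw [hac]; nlinarith
  have hs₂ : IsOpen s := isOpen_setOf_symmPosDef
  have ht : Convex ℝ t := by
    intro w hw w' hw' a c ha hc hac
    refine ⟨?_, ?_⟩
    · rw [matVec_add, matVec_smul, matVec_smul]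
      exact (hw.1.smul a).add (hw'.1.smul c)
    · obtain ⟨d, hd⟩ := hw.2
      obtain ⟨d', hd'⟩ := hw'.2
      refine ⟨a * d + c * d', fun j => ?_⟩
      rw [matVec_add, matVec_smul, matVec_smul, Matrix.mul_add, Matrix.mul_smul, Matrix.mul_smul,
        trace_add, trace_smul, trace_smul, hd, hd', smul_eq_mul, smul_eq_mul]
      ring
  have hdisj : Disjoint s t := by
    rw [Set.disjoint_left]
    rintro w hws ⟨hwsymm, c, hc⟩
    apply hno
    have hwT : (matVec w)ᵀ = matVec w := hwsymm
    have hpos : ∀ v : ι → ℝ, v ≠ 0 → 0 < v ⬝ᵥ (matVec w *ᵥ v) := fun v hv => by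
      have h := hws v hv
      rw [hwT, ← two_smul ℝ (matVec w), smul_mulVec, dotProduct_smul, smul_eq_mul] at h
      linarith
    rcases lt_or_ge 0 c with hc0 | hc0
    · refine ⟨c⁻¹ • matVec w, ?_, fun j => ?_⟩
      · rw [Matrix.posDef_iff_dotProduct_mulVec]
        refine ⟨?_, fun x hx => ?_⟩
        · unfold Matrix.IsHermitian
          rw [conjTranspose_smul, star_trivial, (hherm _ hwsymm).eq]
        · rw [star_trivial, smul_mulVec, dotProduct_smul, smul_eq_mul]
          exact mul_pos (inv_pos.mpr hc0) (hpos x hx)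
      · rw [Matrix.mul_smul, trace_smul, hc, smul_eq_mul, ← mul_assoc, inv_mul_cancel₀ hc0.ne',
          one_mul]
    · refine ⟨matVec w + (1 - c) • X₀, ?_, fun j => ?_⟩
      · rw [Matrix.posDef_iff_dotProduct_mulVec]
        refine ⟨?_, fun x hx => ?_⟩
        · unfold Matrix.IsHermitian
          rw [conjTranspose_add, conjTranspose_smul, star_trivial, (hherm _ hwsymm).eq, hX₀.1.eq]
        · rw [star_trivial, add_mulVec, smul_mulVec, dotProduct_add, dotProduct_smul, smul_eq_mul]
          exact add_pos_of_pos_of_nonneg (hpos x hx) (mul_nonneg (by linarith) (hX₀q x))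
      · rw [Matrix.mul_add, Matrix.mul_smul, trace_add, trace_smul, hc, hfeas, smul_eq_mul]; ring
  -- separate
  obtain ⟨f, u, hfs, hft⟩ := geometric_hahn_banach_open hs₁ hs₂ ht hdisj
  have hmat0 : matVec (0 : EuclideanSpace ℝ (ι × ι)) = 0 := by ext p q; rfl
  have h0t : (0 : EuclideanSpace ℝ (ι × ι)) ∈ t := by
    refine ⟨?_, 0, fun j => ?_⟩
    · show (matVec (0 : EuclideanSpace ℝ (ι × ι))).IsSymm
      rw [hmat0]; exact Matrix.isSymm_zero
    · rw [hmat0, Matrix.mul_zero, trace_zero, zero_mul]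
  have hu : u ≤ 0 := by simpa using hft 0 h0t
  have hft0 : ∀ w ∈ t, f w = 0 := by
    intro w hw
    by_contra hne
    have hsc : ∀ r : ℝ, r • w ∈ t := fun r => by
      refine ⟨by rw [matVec_smul]; exact hw.1.smul r, ?_⟩
      obtain ⟨d, hd⟩ := hw.2
      exact ⟨r * d, fun j => by rw [matVec_smul, Matrix.mul_smul, trace_smul, hd, smul_eq_mul, mul_assoc]⟩
    have h := hft _ (hsc ((u - 1) / f w))
    rw [map_smul, smul_eq_mul, div_mul_cancel₀ _ hne] at h
    linarith
  -- the matrix of `f`, symmetrised and negated: `Ω`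
  let g : ι × ι → ℝ := fun pq => f (EuclideanSpace.single pq (1 : ℝ))
  have hf : ∀ w : EuclideanSpace ℝ (ι × ι), f w = ∑ pq, w pq * g pq := by
    intro w
    conv_lhs => rw [← (EuclideanSpace.basisFun (ι × ι) ℝ).sum_repr w]
    rw [map_sum]
    refine Finset.sum_congr rfl fun pq _ => ?_
    rw [map_smul, EuclideanSpace.basisFun_repr, EuclideanSpace.basisFun_apply, smul_eq_mul]
  let Ω : Matrix ι ι ℝ := Matrix.of fun p q => -((g (p, q) + g (q, p)) / 2)
  have hΩsymm : Ω.IsSymm := by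
    ext p q; simp only [Ω, Matrix.transpose_apply, Matrix.of_apply]; ring
  -- `f(vec S) = −⟨Ω, S⟩` for symmetric `S`
  have hfS : ∀ S : Matrix ι ι ℝ, S.IsSymm → f (vecMat S) = -∑ p, ∑ q, Ω p q * S p q := by
    intro S hS
    have hSqp : ∀ p q, S q p = S p q := fun p q => by
      have := congrFun (congrFun hS p) q; simpa [Matrix.transpose_apply] using this
    rw [hf, Fintype.sum_prod_type]
    simp only [vecMat, PiLp.toLp_apply]
    have hsym : ∑ p, ∑ q, S p q * g (p, q) = ∑ p, ∑ q, S p q * g (q, p) := by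
      rw [Finset.sum_comm]
      exact Finset.sum_congr rfl fun p _ => Finset.sum_congr rfl fun q _ => by rw [hSqp]
    have e1 : ∑ p, ∑ q, Ω p q * S p q =
        (-(1 / 2 : ℝ)) * ∑ p, ∑ q, S p q * g (p, q) + (-(1 / 2 : ℝ)) * ∑ p, ∑ q, S p q * g (q, p) := by
      rw [Finset.mul_sum, Finset.mul_sum, ← Finset.sum_add_distrib]
      refine Finset.sum_congr rfl fun p _ => ?_
      rw [Finset.mul_sum, Finset.mul_sum, ← Finset.sum_add_distrib]
      refine Finset.sum_congr rfl fun q _ => ?_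
      simp only [Ω, Matrix.of_apply]; ring
    rw [e1, ← hsym]; ring
  -- symmetric matrices in the subspace `t` are orthogonal to `Ω`
  have horth : ∀ Y : Matrix ι ι ℝ, Y.IsSymm → (∃ c : ℝ, ∀ j, (A j * Y).trace = c * b j) →
      ∑ p, ∑ q, Ω p q * Y p q = 0 := by
    intro Y hY hc
    have hYt : vecMat Y ∈ t := by
      refine ⟨by rw [matVec_vecMat]; exact hY, ?_⟩
      obtain ⟨c, hc⟩ := hc
      exact ⟨c, fun j => by rw [matVec_vecMat]; exact hc j⟩
    have h := hft0 _ hYt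
    rw [hfS Y hY, neg_eq_zero] at h
    exact h
  -- membership of a symmetric matrix in `s`
  have hmem_s : ∀ S : Matrix ι ι ℝ, S.IsSymm → (∀ v : ι → ℝ, v ≠ 0 → 0 < v ⬝ᵥ (S *ᵥ v)) →
      vecMat S ∈ s := by
    intro S hS hSpos v hv
    show 0 < v ⬝ᵥ ((matVec (vecMat S) + (matVec (vecMat S))ᵀ) *ᵥ v)
    rw [matVec_vecMat, show Sᵀ = S from hS, ← two_smul ℝ S, smul_mulVec, dotProduct_smul, smul_eq_mul]
    linarith [hSpos v hv]
  have hsumsq_pos : ∀ v : ι → ℝ, v ≠ 0 → 0 < ∑ p, v p * v p := fun v hv => by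
    obtain ⟨p, hp⟩ : ∃ p, v p ≠ 0 := by
      by_contra h; push Not at h; exact hv (funext h)
    exact lt_of_lt_of_le (mul_self_pos.mpr hp)
      (Finset.single_le_sum (f := fun p => v p * v p) (fun q _ => mul_self_nonneg (v q))
        (Finset.mem_univ p))
  -- (c) `Tr Ω > 0`, so `Ω ≠ 0`
  have htrace : 0 < Ω.trace := by
    have h1 : vecMat (1 : Matrix ι ι ℝ) ∈ s := hmem_s 1 Matrix.isSymm_one fun v hv => by
      rw [one_mulVec]; exact hsumsq_pos v hv
    have h2 := hfs _ h1
    rw [hfS 1 Matrix.isSymm_one] at h2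
    have h3 : ∑ p, ∑ q, Ω p q * (1 : Matrix ι ι ℝ) p q = Ω.trace := by
      simp only [Matrix.one_apply, mul_ite, mul_one, mul_zero, Finset.sum_ite_eq, Finset.mem_univ,
        if_true, Matrix.trace, Matrix.diag_apply]
    linarith
  have hΩne : Ω ≠ 0 := fun h => by rw [h, trace_zero] at htrace; exact lt_irrefl _ htrace
  -- (b) `Ω ⪰ 0`
  have hΩpsd : Ω.PosSemidef := by
    rw [Matrix.posSemidef_iff_dotProduct_mulVec]
    refine ⟨hherm Ω hΩsymm, fun v => ?_⟩
    rw [star_trivial]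
    by_contra hneg
    push Not at hneg
    set η : ℝ := -(v ⬝ᵥ (Ω *ᵥ v)) with hη
    have hηpos : 0 < η := by rw [hη]; linarith
    set δ : ℝ := η / (2 * (|Ω.trace| + 1)) with hδ
    have hδpos : 0 < δ := by rw [hδ]; positivity
    let S : Matrix ι ι ℝ := vecMulVec v v + δ • (1 : Matrix ι ι ℝ)
    have hSsymm : S.IsSymm := by
      ext p q
      simp only [S, Matrix.transpose_apply, Matrix.add_apply, Matrix.vecMulVec_apply, Matrix.smul_apply,
        Matrix.one_apply, smul_eq_mul]
      rw [mul_comm (v q) (v p)]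
      by_cases h : p = q
      · subst h; rfl
      · rw [if_neg h, if_neg (Ne.symm h)]
    have hSpos : ∀ u : ι → ℝ, u ≠ 0 → 0 < u ⬝ᵥ (S *ᵥ u) := fun u hu => by
      have e : u ⬝ᵥ (S *ᵥ u) = (v ⬝ᵥ u) ^ 2 + δ * ∑ p, u p * u p := by
        simp only [S, add_mulVec, smul_mulVec, one_mulVec, dotProduct_add, dotProduct_smul, smul_eq_mul,
          dotProduct_vecMulVec_mulVec']
        rfl
      rw [e]
      exact add_pos_of_nonneg_of_pos (sq_nonneg _) (mul_pos hδpos (hsumsq_pos u hu))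
    have h2 := hfs _ (hmem_s S hSsymm hSpos)
    rw [hfS S hSsymm] at h2
    -- `⟨Ω, S⟩ = vᵀΩv + δ Tr Ω`
    have h3 : ∑ p, ∑ q, Ω p q * S p q = v ⬝ᵥ (Ω *ᵥ v) + δ * Ω.trace := by
      simp only [S, Matrix.add_apply, Matrix.vecMulVec_apply, Matrix.smul_apply, Matrix.one_apply,
        smul_eq_mul, mul_add, Finset.sum_add_distrib, dotProduct_mulVec_eq_sum]
      congr 1
      simp only [mul_ite, mul_one, mul_zero, Finset.sum_ite_eq, Finset.mem_univ, if_true, Matrix.trace,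
        Matrix.diag_apply, Finset.mul_sum]
      exact Finset.sum_congr rfl fun p _ => by ring
    have h4 : δ * Ω.trace ≤ δ * |Ω.trace| := mul_le_mul_of_nonneg_left (le_abs_self _) hδpos.le
    have h5 : δ * |Ω.trace| < η := by
      rw [hδ, div_mul_eq_mul_div, div_lt_iff₀ (by positivity)]
      nlinarith [abs_nonneg Ω.trace]
    linarith
  -- (d) `ΩX₀ = 0`
  have hΩX₀ : Ω * X₀ = 0 := by
    apply mul_eq_zero_of_posSemidef_trace hΩpsd hX₀
    rw [trace_mul_eq_sum_of_isSymm Ω X₀ hX₀symm]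
    exact horth X₀ hX₀symm ⟨1, fun j => by rw [hfeas, one_mul]⟩
  -- (e) `Ω ∈ span{A_j}`
  let K : Submodule ℝ (EuclideanSpace ℝ (ι × ι)) := Submodule.span ℝ (Set.range fun j => vecMat (A j))
  have hΩK : vecMat Ω ∈ K := by
    rw [← Submodule.orthogonal_orthogonal K]
    rw [Submodule.mem_orthogonal]
    intro z hz
    rw [Submodule.mem_orthogonal] at hz
    -- `Y = mat z` has `⟨A_j, Y⟩ = 0`
    let Y : Matrix ι ι ℝ := matVec z
    have hAY : ∀ j, ∑ p, ∑ q, A j p q * Y p q = 0 := fun j => by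
      have h := hz (vecMat (A j)) (Submodule.subset_span ⟨j, rfl⟩)
      rw [real_inner_comm, inner_vecMat_right] at h
      -- `h : Σ (mat (vec A_j))_{pq} Y_{pq} = 0`… careful: `inner_vecMat_right` pairs `mat z` with `A j`
      simpa [Y, mul_comm] using h
    have hYY : (Y + Yᵀ).IsSymm := by
      show (Y + Yᵀ)ᵀ = Y + Yᵀ
      rw [Matrix.transpose_add, Matrix.transpose_transpose, add_comm]
    have htr : ∀ j, (A j * (Y + Yᵀ)).trace = 0 * b j := fun j => by
      rw [zero_mul, trace_mul_eq_sum_of_isSymm _ _ hYY]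
      simp only [Matrix.add_apply, Matrix.transpose_apply, mul_add, Finset.sum_add_distrib, hAY j, zero_add]
      rw [← sum_mul_eq_sum_mul_transpose_of_isSymm (A j) Y (hA j), hAY j]
    have h0 := horth (Y + Yᵀ) hYY ⟨0, htr⟩
    simp only [Matrix.add_apply, Matrix.transpose_apply, mul_add, Finset.sum_add_distrib] at h0
    rw [← sum_mul_eq_sum_mul_transpose_of_isSymm Ω Y hΩsymm, ← two_mul] at h0
    have h1 : ∑ p, ∑ q, Ω p q * Y p q = 0 := by linarith
    rw [inner_vecMat_right]
    simpa [Y, mul_comm] using h1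
  obtain ⟨y, hy⟩ := (Submodule.mem_span_range_iff_exists_fun ℝ).mp hΩK
  have hyΩ : ∑ j, y j • A j = Ω := by
    have h1 : vecMat (∑ j, y j • A j) = vecMat Ω := by
      rw [vecMat_sum, ← hy]
      exact Finset.sum_congr rfl fun j _ => vecMat_smul _ _
    have h2 := congrArg matVec h1
    rwa [matVec_vecMat, matVec_vecMat] at h2
  exact ⟨y, hyΩ ▸ hΩpsd, hyΩ ▸ hΩne, hyΩ ▸ hΩX₀⟩

/-- **GdLL Lemma 3.8, exclusivity of the two alternatives** (p10): if some `X ≻ 0` satisfies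
`⟨A_j, X⟩ = b_j` for all `j`, then there is no `y` with `Ω = Σ_j y_jA_j ⪰ 0`, `Ω ≠ 0` and `ΩX₀ = 0`
for a feasible `X₀` (`⟨A_j, X₀⟩ = b_j`). Indeed `Tr(ΩX) = Σ_j y_jb_j = Tr(ΩX₀) = 0` forces `ΩX = 0`,
and `X` is invertible. [cite: GriblingDelaatLaurent2017, Lemma 3.8] -/
theorem GriblingDelaatLaurent2017_lemma38_not_both {J : Type*} [Fintype J] (A : J → Matrix ι ι ℝ)
    (b : J → ℝ) (X₀ : Matrix ι ι ℝ) (hfeas : ∀ j, (A j * X₀).trace = b j) (y : J → ℝ)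
    (hΩ : (∑ j, y j • A j).PosSemidef) (hΩne : (∑ j, y j • A j) ≠ 0)
    (hΩX₀ : (∑ j, y j • A j) * X₀ = 0) :
    ¬ ∃ X : Matrix ι ι ℝ, X.PosDef ∧ ∀ j, (A j * X).trace = b j := by
  classical
  rintro ⟨X, hX, hXfeas⟩
  have h1 : ∀ Z : Matrix ι ι ℝ, ((∑ j, y j • A j) * Z).trace = ∑ j, y j * (A j * Z).trace :=
    fun Z => by
      rw [Finset.sum_mul, trace_sum]
      exact Finset.sum_congr rfl fun j _ => by rw [Matrix.smul_mul, trace_smul, smul_eq_mul]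
  have htr : ((∑ j, y j • A j) * X).trace = 0 := by
    have h2 : ((∑ j, y j • A j) * X₀).trace = 0 := by rw [hΩX₀, trace_zero]
    rw [h1] at h2 ⊢
    simp_rw [hXfeas]
    simp_rw [hfeas] at h2
    exact h2
  have h0 := mul_eq_zero_of_posSemidef_trace hΩ hX.posSemidef htr
  apply hΩne
  have hdet : IsUnit X.det := isUnit_iff_ne_zero.mpr hX.det_pos.ne'
  calc (∑ j, y j • A j) = (∑ j, y j • A j) * X * X⁻¹ :=
      (Matrix.mul_nonsing_inv_cancel_right X _ hdet).symm
    _ = 0 := by rw [h0, Matrix.zero_mul]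

end SdpAlternative

end Literature.Combinatorics.Optimization
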